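import Summits.BirchSwinnertonDyer.BirchSwinnertonDyer.Theorems.GenusKolyvaginAtTwoMinimalTwinBSDTwoUniformByName
import Summits.BirchSwinnertonDyer.BirchSwinnertonDyer.Theorems.GenusKolyvaginAtTwoLeafCensusWallResidual
import HarnessLib

/-!
# Route `GenusKolyvaginAtTwo`: THE DECLARED RESIDUAL IS GROSS'S CONJECTURE AT 2 — given WALL row 1 + PRINT + Friedberg–Hoffstein,
# `OffHabitatResidualAtTwo` (stmt-BirchSwinnertonDyer-22139) ⟺ IDX (the 2-primary Gross–Zagier index relation for non-CM rank-one curves)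

Seat `bsd-line-gk2-p2` g27 (PROVER seat 2/3, cell `bsd-f1-sign2`, LINE 23 holder on U₂ stmt-22985), `--supports stmt-BirchSwinnertonDyer-22985` (helper;
closes nothing).  ONE THEOREM + one corollary; standard axioms.  **BSD is NOT proved by this file; the residual, the leaf and IDX are NOT proved; nothing
is closed.**  A CENSUS statement composing LEAD gk2-p1 g27's `Census.nonCMAtTwo_iff_wallRows_and_offHabitatResidual` (p783309: leaf ⟺ WALL row 1 ∧
residual) with this seat's `Uniform.nonCMAtTwo_iff_idx_of_wallItems` (p788934: given WALL row 1 + PRINT + FH, leaf ⟺ IDX): modulo the four WALL row 1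
items of route ByReductionTypeAtTwo (stmt-19095–19098), this route's PRINT items, BCDT and Friedberg–Hoffstein, the route's declared residual
`OffHabitatResidualAtTwo` is EQUIVALENT to the single ∀-statement IDX `#Ш(W_K)[2^∞] · 4^{ord₂ c + ord₂ C(W)} = 4^{ord₂ [W(K):ℤP_K]}` (non-CM `W`, `r_an = 1`,
`K` a Friedberg–Hoffstein field, `P_K` the Heegner point) — Gross's conjecture (GZ V (2.2) ⊗ BSD) at `p = 2`.

References: [GrossZagier1986] V.§2 (2.2); [FriedbergHoffstein1995] main theorem; [Milne1972ArithmeticAV] §1 Thm. 1; [Miller2011LMS] Def. 1.1.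
-/

set_option linter.dupNamespace false -- `Summit.<P>.<Sub>` repeats `BirchSwinnertonDyer` (D-0017)

noncomputable section

open scoped Classical NumberField

open WeierstrassCurve NumberField Literature.NumberTheory.EllipticCurves Literature.NumberTheory.EllipticCurves.ModularForms
open Summit.BirchSwinnertonDyer.BirchSwinnertonDyer.Theses.GenusKolyvaginAtTwo
  (OffHabitatResidualAtTwo GrossZagierAllLevels MultPublishedInputsAtTwo EntireLFunctionRat MilneAnyModel)
open Summit.BirchSwinnertonDyer.BirchSwinnertonDyer.Theses.ByReductionTypeAtTwo
  (GoodOrdinaryRankZeroAtTwo MultiplicativeRankZeroAtTwo SupersingularRankZeroAtTwo AdditiveRankZeroAtTwo)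
open Summit.BirchSwinnertonDyer.BirchSwinnertonDyer.Rank1Residual (NonCMAtTwo)
open Summit.BirchSwinnertonDyer.BirchSwinnertonDyer.Theorems.GenusExact.Census
  (nonCMAtTwo_iff_wallRows_and_offHabitatResidual nonCMAtTwo_of_wallRows_of_offHabitatResidual)
open Summit.BirchSwinnertonDyer.BirchSwinnertonDyer.Theorems.GenusExact.TwinSwap.Uniform (nonCMAtTwo_iff_idx_of_wallItems)

namespace Summit.BirchSwinnertonDyer.BirchSwinnertonDyer.Theorems.GenusExact.TwinSwap.ResidualCensus

/-- ★ **THE DECLARED RESIDUAL IS GROSS'S CONJECTURE AT 2.**  Given the four WALL row 1 items (ByReductionTypeAtTwo stmt-19095–19098), the PRINT items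
`GrossZagierAllLevels` / `MultPublishedInputsAtTwo` / `EntireLFunctionRat` / `MilneAnyModel`, BCDT `nonempty_modularParametrizationData` and Friedberg–Hoffstein
`friedbergHoffstein_exists_heegnerField_split_twist_ne_zero`: the route's declared residual `OffHabitatResidualAtTwo` (stmt-BirchSwinnertonDyer-22139) ↔ IDX
(the `2`-primary Gross–Zagier index relation for every non-CM globally minimal `W` with `r_an = 1` at every imaginary quadratic `K` with `d_K < −4`, Heegner,
`2` split, `L(W^{(d_K)},1) ≠ 0`, every datum and Heegner point).  `→`: residual + WALL ⟹ leaf (LEAD p783309) ⟹ IDX (p788934, lossless); `←`: IDX + WALL ⟹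
leaf (p788934) ⟹ residual (p783309).  CONDITIONAL; census only; nothing about BSD is proved; closes nothing.
[cite: GrossZagier1986, V.§2 (2.2)] [cite: FriedbergHoffstein1995, main theorem] [cite: Miller2011LMS, Def. 1.1] -/
theorem offHabitatResidualAtTwo_iff_idx_of_wallItems (hOrd : GoodOrdinaryRankZeroAtTwo) (hMult : MultiplicativeRankZeroAtTwo)
    (hSS : SupersingularRankZeroAtTwo) (hAdd : AdditiveRankZeroAtTwo)
    (hGZ : GrossZagierAllLevels) (hGZK : MultPublishedInputsAtTwo) (hL : EntireLFunctionRat) (hMi : MilneAnyModel)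
    (hMP : nonempty_modularParametrizationData) (hFH : friedbergHoffstein_exists_heegnerField_split_twist_ne_zero) :
    OffHabitatResidualAtTwo ↔
      ∀ (W : WeierstrassCurve ℚ) [W.IsElliptic] [W.IsGloballyMinimal] [NeZero (W.conductorNorm ℤ)],
        ¬ W.HasCM → W.analyticRank = 1 →
        ∀ (K : Type) [Field K] [NumberField K], IsImaginaryQuadratic K → NumberField.discr K < -4 →
          SatisfiesHeegnerHypothesis (W.conductorNorm ℤ) K → SatisfiesHeegnerHypothesis 2 K →
          (W.quadraticTwist (NumberField.discr K : ℚ)).entireLFunction 1 ≠ 0 →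
          ∀ (Dt : ModularParametrizationData W (W.conductorNorm ℤ)) (H : HeegnerDatum (W.conductorNorm ℤ) (NumberField.discr K))
            (ι : K →+* ℂ) (P : (W.baseChange K).toAffine.Point),
            WeierstrassCurve.Affine.Point.map ι.toRatAlgHom P = heegnerPointComplex Dt H →
            Nat.card (AddCommGroup.primaryComponent (W.baseChange K).sha 2) *
                2 ^ (2 * (padicValInt 2 Dt.c + padicValNat 2 W.tamagawaProduct)) =
              2 ^ (2 * padicValNat 2 (AddSubgroup.zmultiples P).index) :=
  ⟨fun hR ↦ (nonCMAtTwo_iff_idx_of_wallItems hOrd hMult hSS hAdd hGZ hGZK hL hMi hMP hFH).mp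
      (nonCMAtTwo_of_wallRows_of_offHabitatResidual hOrd hMult hSS hAdd hR),
    fun hI ↦ (nonCMAtTwo_iff_wallRows_and_offHabitatResidual.mp
      ((nonCMAtTwo_iff_idx_of_wallItems hOrd hMult hSS hAdd hGZ hGZK hL hMi hMP hFH).mpr hI)).2⟩

/-- **Corollary (the three-way census in one statement).**  Given WALL row 1 + PRINT + FH, the following are equivalent: (a) the leaf `NonCMAtTwo`;
(b) the route's declared residual `OffHabitatResidualAtTwo`; (c) IDX.  CONDITIONAL; census only; nothing proved about BSD. [folklore] -/
theorem nonCMAtTwo_iff_offHabitatResidual_and_offHabitatResidual_iff_idx_of_wallItems (hOrd : GoodOrdinaryRankZeroAtTwo)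
    (hMult : MultiplicativeRankZeroAtTwo) (hSS : SupersingularRankZeroAtTwo) (hAdd : AdditiveRankZeroAtTwo)
    (hGZ : GrossZagierAllLevels) (hGZK : MultPublishedInputsAtTwo) (hL : EntireLFunctionRat) (hMi : MilneAnyModel)
    (hMP : nonempty_modularParametrizationData) (hFH : friedbergHoffstein_exists_heegnerField_split_twist_ne_zero) :
    (NonCMAtTwo ↔ OffHabitatResidualAtTwo) ∧
    (OffHabitatResidualAtTwo ↔
      ∀ (W : WeierstrassCurve ℚ) [W.IsElliptic] [W.IsGloballyMinimal] [NeZero (W.conductorNorm ℤ)],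
        ¬ W.HasCM → W.analyticRank = 1 →
        ∀ (K : Type) [Field K] [NumberField K], IsImaginaryQuadratic K → NumberField.discr K < -4 →
          SatisfiesHeegnerHypothesis (W.conductorNorm ℤ) K → SatisfiesHeegnerHypothesis 2 K →
          (W.quadraticTwist (NumberField.discr K : ℚ)).entireLFunction 1 ≠ 0 →
          ∀ (Dt : ModularParametrizationData W (W.conductorNorm ℤ)) (H : HeegnerDatum (W.conductorNorm ℤ) (NumberField.discr K))
            (ι : K →+* ℂ) (P : (W.baseChange K).toAffine.Point),
            WeierstrassCurve.Affine.Point.map ι.toRatAlgHom P = heegnerPointComplex Dt H →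
            Nat.card (AddCommGroup.primaryComponent (W.baseChange K).sha 2) *
                2 ^ (2 * (padicValInt 2 Dt.c + padicValNat 2 W.tamagawaProduct)) =
              2 ^ (2 * padicValNat 2 (AddSubgroup.zmultiples P).index)) :=
  ⟨⟨fun h ↦ (nonCMAtTwo_iff_wallRows_and_offHabitatResidual.mp h).2,
      fun hR ↦ nonCMAtTwo_of_wallRows_of_offHabitatResidual hOrd hMult hSS hAdd hR⟩,
    offHabitatResidualAtTwo_iff_idx_of_wallItems hOrd hMult hSS hAdd hGZ hGZK hL hMi hMP hFH⟩

end Summit.BirchSwinnertonDyer.BirchSwinnertonDyer.Theorems.GenusExact.TwinSwap.ResidualCensus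

end
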